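import Summits.AnomalousDissipation.AnomalousDissipation.Theorems.SawtoothPulseCascadeK1LocalisedCascadeOscJunkBounds
import Summits.AnomalousDissipation.AnomalousDissipation.Theorems.SawtoothPulseCascadeK1LocalisedCascadePhaseSums

/-!
# K1loc — helper: THE SIX OSCILLATORY JUNK AMPLITUDES AND THE FAR TERMS AGAINST RATIONAL CERTIFICATES (numeric layer, typed tools)

Helper file of the prover lane on the crux `K1LocalisedCascade` (stmt-AnomalousDissipation-19491), route `SawtoothPulseCascade`
(S-B/S-C assembly seat; the LEDGER ASSEMBLY, numeric layer; companion of `…OscJunkBounds`).  The closed-form junk amplitudes of the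
six oscillatory class steps, VERBATIM as they occur in `…PhaseStepOsc.resolved_step_osc` (T = low fibres, S = strip, C = subcone,
O = off-cone; phase `j`, window `K`, rounding target `ε`) and in `…ShellChainOsc.sqrt_shell_le_far_add_sum_osc` (A = shell, B = shallow;
phase `t`, threshold `Y`), are bounded by a rational `w` from rational CERTIFICATES decided by `norm_num` at each instance:
a power of two `2^m ≥ 1/η` (rounding target), `M₀ ≥ max(1, √(1.3862943616·m))` (zone depth), `δ₀ ≤ δ*`, `s² ≥ 4M₀δ*/(2^j·3.141592·D)`,
`e₀ ≥ ε²` and `w² ≥` the rational junk (`…OscJunkBounds.oscJunk_le'`):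
* `sqrt_juncT_le`, `sqrt_juncS_le`, `sqrt_juncC_le`, `sqrt_juncO_le`, `sqrt_juncA_le`, `sqrt_juncB_le` — each also returns the zone bound
  `max(1,√(2log(1/η)))·δ_j ≤ M₀·δ*/2^j` used for the side condition `< π/2` (`…OscJunkBounds.zoneDepth_lt_pi_half`);
* the far terms for `γ = 8`: `far_sq_le` (`((1+γ)^{2t}/X)² ≤ φ` from `81^t ≤ ψ·X`, `φ = ψ²`), `sqrt_far_sq_le` (`√(…)² ≤ ψ`), `far_head_le`
  (`(1+γ)^{2j₁}/Y ≤ φ`);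
* `shell_zone_cond` — the side conditions `∀ i, max(1,√(2log(1/(η₀·(1/64)^i))))·δ_i < π/2` of `…ShellChainOsc` from ONE certificate on `η₀`
  (`…PhaseSums.zoneDepth_le_affine`, `affine_div_two_pow_le`);
* `omega_osc_le` — one summand `ω_t = √J_A(t) + √J_B(t) + √f_A(t) + √f_B(t)` of the shell chain `≤ w_A + w_B + ψ_A + ψ_B`;
* `resolvedJunk_le` — the increment of `resolved_step_osc`, `e = w_T² + 2w_T·o + (√J_S + √J_C + 𝔞 + √f_C)² + (√J_O + √J_C + 𝔞 + √f_C)² + f_S + f_T + f_O`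
  with `w_T = √J_T`, against the certified amplitudes (the off-cone amplitude `o` is kept symbolic).
Pure real arithmetic; no definitions; no statement about the crux. [cite: Grafakos2014, Prop. 3.2.7 (3)] [problem: turb]
-/

-- `Summit.<Summit>.<Problem>`: single-conjunct summit, the duplicate namespace segment is deliberate.
set_option linter.dupNamespace false

noncomputable section

namespace Summit.AnomalousDissipation.AnomalousDissipation.Theorems.SawtoothPulseCascade.K1Window

open Real
open Literature.Analysis.FluidPDE.SawtoothCascade Literature.Analysis.FluidPDE.SawtoothCascade.CascadeParams

/-! ## §1 The generic amplitude bound behind the six instances -/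

/-- **Generic certified junk amplitude.**  For the junk shape of `…OscJunkBounds.oscJunk_le'` with rounding target
`η = ε/(A·π·8·P·X)·(1/64)^j` and zone depth `Z = max(1,√(2log(1/η)))·δ_j` (`d = 2`, `0 ≤ δ₀ ≤ δ*`): the certificates
`A·3.1416·8·P·X·64^j/ε ≤ 2^m`, `1 ≤ M₀`, `1.3862943616·m ≤ M₀²`, `0 ≤ s`, `4(M₀δ*/2^j)/(3.141592·D) ≤ s²`, `ε² ≤ e₀`, `0 ≤ w`,
`3r²(4/3e₀ + 4/3(2N/(3.141592D))² + 8NA/(3.141592D) + c(8NA²s + 8A²(M₀δ*/2^j)/3.141592)) ≤ w²` give `√J ≤ w` and `Z ≤ M₀δ*/2^j`.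
[folklore] -/
theorem sqrt_oscJunk_le_of_cert (P : CascadeParams) (hd : P.d = 2) {δs : ℝ} (hδ₀ : 0 ≤ P.δ₀) (hδ₀' : P.δ₀ ≤ δs)
    {r ε N A Pw X D c : ℝ} (hε : 0 < ε) (hN : 0 ≤ N) (hA : 0 < A) (hPw : 0 < Pw) (hX : 0 < X) (hD : 0 < D) (hc : 0 ≤ c) (j : ℕ)
    {m : ℕ} {M₀ s e₀ w : ℝ} (hm : A * 3.1416 * 8 * Pw * X * 64 ^ j / ε ≤ 2 ^ m) (hM₀ : 1 ≤ M₀) (hM : 1.3862943616 * m ≤ M₀ ^ 2)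
    (hs0 : 0 ≤ s) (hs : 4 * (M₀ * (δs / 2 ^ j)) / (3.141592 * D) ≤ s ^ 2) (he : ε ^ 2 ≤ e₀) (hw : 0 ≤ w)
    (hJ : 3 * r ^ 2 * (4 / 3 * e₀ + 4 / 3 * (2 * N / (3.141592 * D)) ^ 2 + 8 * N * A / (3.141592 * D) +
        c * (8 * N * A ^ 2 * s + 8 * A ^ 2 * (M₀ * (δs / 2 ^ j)) / 3.141592)) ≤ w ^ 2) :
    Real.sqrt (3 * r ^ 2 * (4 / 3 * ε ^ 2 + 4 / 3 * (2 * N / (π * D)) ^ 2 + 8 * N * A / (π * D) +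
        c * (8 * N * A ^ 2 * Real.sqrt (4 * (max 1 (Real.sqrt (2 * Real.log (1 / (ε / (A * π * 8 * Pw * X) * (1 / 64) ^ j)))) * P.δ j) / (π * D)) +
          8 * A ^ 2 * (max 1 (Real.sqrt (2 * Real.log (1 / (ε / (A * π * 8 * Pw * X) * (1 / 64) ^ j)))) * P.δ j) / π))) ≤ w ∧
      max 1 (Real.sqrt (2 * Real.log (1 / (ε / (A * π * 8 * Pw * X) * (1 / 64) ^ j)))) * P.δ j ≤ M₀ * (δs / 2 ^ j) := by
  obtain ⟨hδ0, hδle⟩ := P.delta_le_of_le hd hδ₀ hδ₀' j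
  have hη := rounding_target_pos (ε := ε) (A := A) (Pw := Pw) (X := X) j hε hA hPw hX
  have hinv : 1 / (ε / (A * π * 8 * Pw * X) * (1 / 64) ^ j) ≤ 2 ^ m :=
    (inv_rounding_target_le j hε hA.le hPw.le hX.le).trans hm
  have hM1 := zoneDepth_le hη hinv hM₀ hM
  have hZ : max 1 (Real.sqrt (2 * Real.log (1 / (ε / (A * π * 8 * Pw * X) * (1 / 64) ^ j)))) * P.δ j ≤ M₀ * (δs / 2 ^ j) :=
    (mul_le_mul_of_nonneg_right hM1 hδ0).trans (mul_le_mul_of_nonneg_left hδle (by linarith))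
  have hZ0 : 0 ≤ max 1 (Real.sqrt (2 * Real.log (1 / (ε / (A * π * 8 * Pw * X) * (1 / 64) ^ j)))) * P.δ j :=
    mul_nonneg (le_max_left _ _ |>.trans' zero_le_one) hδ0
  refine ⟨Real.sqrt_le_iff.mpr ⟨hw, ?_⟩, hZ⟩
  exact (oscJunk_le' (r := r) hD hN hA.le hc hZ0 hZ (by nlinarith) hs0 hs).trans hJ

/-! ## §2 The four amplitudes of `resolved_step_osc` (phase `j`, window `K`) -/

/-- **(T) low-fibre junk amplitude** (`r = 2`, `A* = 15`, `D₀ = K`, `2^p = 4096`, `X = K`, `M_b = 7j + 12`). [folklore] -/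
theorem sqrt_juncT_le (P : CascadeParams) (hd : P.d = 2) {δs : ℝ} (hδ₀ : 0 ≤ P.δ₀) (hδ₀' : P.δ₀ ≤ δs) {K : ℕ} (hK : 0 < K)
    {ε : ℝ} (hε : 0 < ε) (j : ℕ) {m : ℕ} {M₀ s e₀ w : ℝ}
    (hm : 15 * 3.1416 * 8 * 4096 * (K : ℝ) * 64 ^ j / ε ≤ 2 ^ m) (hM₀ : 1 ≤ M₀) (hM : 1.3862943616 * m ≤ M₀ ^ 2)
    (hs0 : 0 ≤ s) (hs : 4 * (M₀ * (δs / 2 ^ j)) / (3.141592 * (K : ℝ)) ≤ s ^ 2) (he : ε ^ 2 ≤ e₀) (hw : 0 ≤ w)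
    (hJ : 3 * 2 ^ 2 * (4 / 3 * e₀ + 4 / 3 * (2 * 2 ^ j / (3.141592 * (K : ℝ))) ^ 2 + 8 * 2 ^ j * 15 / (3.141592 * (K : ℝ)) +
        ((7 * j + 12 : ℕ) : ℝ) * (8 * 2 ^ j * 15 ^ 2 * s + 8 * 15 ^ 2 * (M₀ * (δs / 2 ^ j)) / 3.141592)) ≤ w ^ 2) :
    Real.sqrt (3 * 2 ^ 2 *
        (4 / 3 * ε ^ 2 + 4 / 3 * (2 * 2 ^ j / (π * (K : ℝ))) ^ 2 + 8 * 2 ^ j * 15 / (π * (K : ℝ)) +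
          ((7 * j + 12 : ℕ) : ℝ) * (8 * 2 ^ j * 15 ^ 2 *
            Real.sqrt (4 * (max 1 (Real.sqrt (2 * Real.log (1 / (ε / (15 * π * 8 * 4096 * (K : ℝ)) * (1 / 64) ^ j)))) * P.δ j) / (π * (K : ℝ))) +
            8 * 15 ^ 2 * (max 1 (Real.sqrt (2 * Real.log (1 / (ε / (15 * π * 8 * 4096 * (K : ℝ)) * (1 / 64) ^ j)))) * P.δ j) / π))) ≤ w ∧
      max 1 (Real.sqrt (2 * Real.log (1 / (ε / (15 * π * 8 * 4096 * (K : ℝ)) * (1 / 64) ^ j)))) * P.δ j ≤ M₀ * (δs / 2 ^ j) := by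
  have hK' : (0 : ℝ) < K := Nat.cast_pos.mpr hK
  exact sqrt_oscJunk_le_of_cert P hd hδ₀ hδ₀' (r := 2) (c := ((7 * j + 12 : ℕ) : ℝ)) hε (by positivity) (by norm_num) (by norm_num)
    hK' hK' (by positivity) j hm hM₀ hM hs0 hs he hw hJ

/-- **(S) strip junk amplitude** (`r = 81/39`, `A* = 15`, `D₀ = 5K`, `2^p = 2^19`, `X = 5K`, `M_b = 7j + 19`). [folklore] -/
theorem sqrt_juncS_le (P : CascadeParams) (hd : P.d = 2) {δs : ℝ} (hδ₀ : 0 ≤ P.δ₀) (hδ₀' : P.δ₀ ≤ δs) {K : ℕ} (hK : 0 < K)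
    {ε : ℝ} (hε : 0 < ε) (j : ℕ) {m : ℕ} {M₀ s e₀ w : ℝ}
    (hm : 15 * 3.1416 * 8 * 2 ^ 19 * ((5 * K : ℕ) : ℝ) * 64 ^ j / ε ≤ 2 ^ m) (hM₀ : 1 ≤ M₀) (hM : 1.3862943616 * m ≤ M₀ ^ 2)
    (hs0 : 0 ≤ s) (hs : 4 * (M₀ * (δs / 2 ^ j)) / (3.141592 * (5 * (K : ℝ))) ≤ s ^ 2) (he : ε ^ 2 ≤ e₀) (hw : 0 ≤ w)
    (hJ : 3 * (81 / 39) ^ 2 * (4 / 3 * e₀ + 4 / 3 * (2 * 2 ^ j / (3.141592 * (5 * (K : ℝ)))) ^ 2 + 8 * 2 ^ j * 15 / (3.141592 * (5 * (K : ℝ))) +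
        ((7 * j + 19 : ℕ) : ℝ) * (8 * 2 ^ j * 15 ^ 2 * s + 8 * 15 ^ 2 * (M₀ * (δs / 2 ^ j)) / 3.141592)) ≤ w ^ 2) :
    Real.sqrt (3 * (81 / 39) ^ 2 *
        (4 / 3 * ε ^ 2 + 4 / 3 * (2 * 2 ^ j / (π * (5 * (K : ℝ)))) ^ 2 + 8 * 2 ^ j * 15 / (π * (5 * (K : ℝ))) +
          ((7 * j + 19 : ℕ) : ℝ) * (8 * 2 ^ j * 15 ^ 2 *
            Real.sqrt (4 * (max 1 (Real.sqrt (2 * Real.log (1 / (ε / (15 * π * 8 * 2 ^ 19 * ((5 * K : ℕ) : ℝ)) * (1 / 64) ^ j)))) * P.δ j) / (π * (5 * (K : ℝ)))) +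
            8 * 15 ^ 2 * (max 1 (Real.sqrt (2 * Real.log (1 / (ε / (15 * π * 8 * 2 ^ 19 * ((5 * K : ℕ) : ℝ)) * (1 / 64) ^ j)))) * P.δ j) / π))) ≤ w ∧
      max 1 (Real.sqrt (2 * Real.log (1 / (ε / (15 * π * 8 * 2 ^ 19 * ((5 * K : ℕ) : ℝ)) * (1 / 64) ^ j)))) * P.δ j ≤ M₀ * (δs / 2 ^ j) := by
  have hK' : (0 : ℝ) < K := Nat.cast_pos.mpr hK
  have hX : (0 : ℝ) < ((5 * K : ℕ) : ℝ) := by positivity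
  exact sqrt_oscJunk_le_of_cert P hd hδ₀ hδ₀' (r := 81 / 39) (c := ((7 * j + 19 : ℕ) : ℝ)) hε (by positivity) (by norm_num) (by norm_num)
    hX (by positivity) (by positivity) j hm hM₀ hM hs0 hs he hw hJ

/-- **(C) subcone junk amplitude** (`r = 77/37`, `A* = 7`, `D₀ = 2(3K+1)`, `2^p = 2^19`, `X = 3K+1`, `M_b = 7j + 19`). [folklore] -/
theorem sqrt_juncC_le (P : CascadeParams) (hd : P.d = 2) {δs : ℝ} (hδ₀ : 0 ≤ P.δ₀) (hδ₀' : P.δ₀ ≤ δs) (K : ℕ)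
    {ε : ℝ} (hε : 0 < ε) (j : ℕ) {m : ℕ} {M₀ s e₀ w : ℝ}
    (hm : 7 * 3.1416 * 8 * 2 ^ 19 * ((3 * K + 1 : ℕ) : ℝ) * 64 ^ j / ε ≤ 2 ^ m) (hM₀ : 1 ≤ M₀) (hM : 1.3862943616 * m ≤ M₀ ^ 2)
    (hs0 : 0 ≤ s) (hs : 4 * (M₀ * (δs / 2 ^ j)) / (3.141592 * (2 * ((3 * K + 1 : ℕ) : ℝ))) ≤ s ^ 2) (he : ε ^ 2 ≤ e₀) (hw : 0 ≤ w)
    (hJ : 3 * (77 / 37) ^ 2 * (4 / 3 * e₀ + 4 / 3 * (2 * 2 ^ j / (3.141592 * (2 * ((3 * K + 1 : ℕ) : ℝ)))) ^ 2 +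
        8 * 2 ^ j * 7 / (3.141592 * (2 * ((3 * K + 1 : ℕ) : ℝ))) +
        ((7 * j + 19 : ℕ) : ℝ) * (8 * 2 ^ j * 7 ^ 2 * s + 8 * 7 ^ 2 * (M₀ * (δs / 2 ^ j)) / 3.141592)) ≤ w ^ 2) :
    Real.sqrt (3 * (77 / 37) ^ 2 *
        (4 / 3 * ε ^ 2 + 4 / 3 * (2 * 2 ^ j / (π * (2 * ((3 * K + 1 : ℕ) : ℝ)))) ^ 2 + 8 * 2 ^ j * 7 / (π * (2 * ((3 * K + 1 : ℕ) : ℝ))) +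
          ((7 * j + 19 : ℕ) : ℝ) * (8 * 2 ^ j * 7 ^ 2 *
            Real.sqrt (4 * (max 1 (Real.sqrt (2 * Real.log (1 / (ε / (7 * π * 8 * 2 ^ 19 * ((3 * K + 1 : ℕ) : ℝ)) * (1 / 64) ^ j)))) * P.δ j) / (π * (2 * ((3 * K + 1 : ℕ) : ℝ)))) +
            8 * 7 ^ 2 * (max 1 (Real.sqrt (2 * Real.log (1 / (ε / (7 * π * 8 * 2 ^ 19 * ((3 * K + 1 : ℕ) : ℝ)) * (1 / 64) ^ j)))) * P.δ j) / π))) ≤ w ∧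
      max 1 (Real.sqrt (2 * Real.log (1 / (ε / (7 * π * 8 * 2 ^ 19 * ((3 * K + 1 : ℕ) : ℝ)) * (1 / 64) ^ j)))) * P.δ j ≤ M₀ * (δs / 2 ^ j) := by
  have hX : (0 : ℝ) < ((3 * K + 1 : ℕ) : ℝ) := by positivity
  exact sqrt_oscJunk_le_of_cert P hd hδ₀ hδ₀' (r := 77 / 37) (c := ((7 * j + 19 : ℕ) : ℝ)) hε (by positivity) (by norm_num) (by norm_num)
    hX (by positivity) (by positivity) j hm hM₀ hM hs0 hs he hw hJ

/-- **(O) off-cone junk amplitude** (`r = 81/39`, `A* = 7`, `D₀ = 12K`, `2^p = 2^19`, `X = 6K`, `M_b = 7j + 19`). [folklore] -/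
theorem sqrt_juncO_le (P : CascadeParams) (hd : P.d = 2) {δs : ℝ} (hδ₀ : 0 ≤ P.δ₀) (hδ₀' : P.δ₀ ≤ δs) {K : ℕ} (hK : 0 < K)
    {ε : ℝ} (hε : 0 < ε) (j : ℕ) {m : ℕ} {M₀ s e₀ w : ℝ}
    (hm : 7 * 3.1416 * 8 * 2 ^ 19 * ((6 * K : ℕ) : ℝ) * 64 ^ j / ε ≤ 2 ^ m) (hM₀ : 1 ≤ M₀) (hM : 1.3862943616 * m ≤ M₀ ^ 2)
    (hs0 : 0 ≤ s) (hs : 4 * (M₀ * (δs / 2 ^ j)) / (3.141592 * (12 * (K : ℝ))) ≤ s ^ 2) (he : ε ^ 2 ≤ e₀) (hw : 0 ≤ w)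
    (hJ : 3 * (81 / 39) ^ 2 * (4 / 3 * e₀ + 4 / 3 * (2 * 2 ^ j / (3.141592 * (12 * (K : ℝ)))) ^ 2 + 8 * 2 ^ j * 7 / (3.141592 * (12 * (K : ℝ))) +
        ((7 * j + 19 : ℕ) : ℝ) * (8 * 2 ^ j * 7 ^ 2 * s + 8 * 7 ^ 2 * (M₀ * (δs / 2 ^ j)) / 3.141592)) ≤ w ^ 2) :
    Real.sqrt (3 * (81 / 39) ^ 2 *
        (4 / 3 * ε ^ 2 + 4 / 3 * (2 * 2 ^ j / (π * (12 * (K : ℝ)))) ^ 2 + 8 * 2 ^ j * 7 / (π * (12 * (K : ℝ))) +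
          ((7 * j + 19 : ℕ) : ℝ) * (8 * 2 ^ j * 7 ^ 2 *
            Real.sqrt (4 * (max 1 (Real.sqrt (2 * Real.log (1 / (ε / (7 * π * 8 * 2 ^ 19 * ((6 * K : ℕ) : ℝ)) * (1 / 64) ^ j)))) * P.δ j) / (π * (12 * (K : ℝ)))) +
            8 * 7 ^ 2 * (max 1 (Real.sqrt (2 * Real.log (1 / (ε / (7 * π * 8 * 2 ^ 19 * ((6 * K : ℕ) : ℝ)) * (1 / 64) ^ j)))) * P.δ j) / π))) ≤ w ∧
      max 1 (Real.sqrt (2 * Real.log (1 / (ε / (7 * π * 8 * 2 ^ 19 * ((6 * K : ℕ) : ℝ)) * (1 / 64) ^ j)))) * P.δ j ≤ M₀ * (δs / 2 ^ j) := by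
  have hK' : (0 : ℝ) < K := Nat.cast_pos.mpr hK
  have hX : (0 : ℝ) < ((6 * K : ℕ) : ℝ) := by positivity
  exact sqrt_oscJunk_le_of_cert P hd hδ₀ hδ₀' (r := 81 / 39) (c := ((7 * j + 19 : ℕ) : ℝ)) hε (by positivity) (by norm_num) (by norm_num)
    hX (by positivity) (by positivity) j hm hM₀ hM hs0 hs he hw hJ

/-! ## §3 The two amplitudes of the shell chain (phase `t`, threshold `Y`) -/

/-- **(A) shell junk amplitude** (`r = 37/11`, `A* = 7`, `D₀ = 2⌊Y/2⌋`, `2^p = 2^20`, `X = ⌊Y/2⌋`, `M_b = 7t + 20`). [folklore] -/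
theorem sqrt_juncA_le (P : CascadeParams) (hd : P.d = 2) {δs : ℝ} (hδ₀ : 0 ≤ P.δ₀) (hδ₀' : P.δ₀ ≤ δs) {Y : ℕ} (hY : 0 < Y / 2)
    {ε : ℝ} (hε : 0 < ε) (t : ℕ) {m : ℕ} {M₀ s e₀ w : ℝ}
    (hm : 7 * 3.1416 * 8 * 2 ^ 20 * ((Y / 2 : ℕ) : ℝ) * 64 ^ t / ε ≤ 2 ^ m) (hM₀ : 1 ≤ M₀) (hM : 1.3862943616 * m ≤ M₀ ^ 2)
    (hs0 : 0 ≤ s) (hs : 4 * (M₀ * (δs / 2 ^ t)) / (3.141592 * (2 * ((Y / 2 : ℕ) : ℝ))) ≤ s ^ 2) (he : ε ^ 2 ≤ e₀) (hw : 0 ≤ w)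
    (hJ : 3 * (37 / 11) ^ 2 * (4 / 3 * e₀ + 4 / 3 * (2 * 2 ^ t / (3.141592 * (2 * ((Y / 2 : ℕ) : ℝ)))) ^ 2 +
        8 * 2 ^ t * 7 / (3.141592 * (2 * ((Y / 2 : ℕ) : ℝ))) +
        ((7 * t + 20 : ℕ) : ℝ) * (8 * 2 ^ t * 7 ^ 2 * s + 8 * 7 ^ 2 * (M₀ * (δs / 2 ^ t)) / 3.141592)) ≤ w ^ 2) :
    Real.sqrt (3 * (37 / 11) ^ 2 *
        (4 / 3 * ε ^ 2 + 4 / 3 * (2 * 2 ^ t / (π * (2 * ((Y / 2 : ℕ) : ℝ)))) ^ 2 + 8 * 2 ^ t * 7 / (π * (2 * ((Y / 2 : ℕ) : ℝ))) +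
          ((7 * t + 20 : ℕ) : ℝ) * (8 * 2 ^ t * 7 ^ 2 *
            Real.sqrt (4 * (max 1 (Real.sqrt (2 * Real.log (1 / (ε / (7 * π * 8 * 2 ^ 20 * ((Y / 2 : ℕ) : ℝ)) * (1 / 64) ^ t)))) * P.δ t) / (π * (2 * ((Y / 2 : ℕ) : ℝ)))) +
            8 * 7 ^ 2 * (max 1 (Real.sqrt (2 * Real.log (1 / (ε / (7 * π * 8 * 2 ^ 20 * ((Y / 2 : ℕ) : ℝ)) * (1 / 64) ^ t)))) * P.δ t) / π))) ≤ w ∧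
      max 1 (Real.sqrt (2 * Real.log (1 / (ε / (7 * π * 8 * 2 ^ 20 * ((Y / 2 : ℕ) : ℝ)) * (1 / 64) ^ t)))) * P.δ t ≤ M₀ * (δs / 2 ^ t) := by
  have hX : (0 : ℝ) < ((Y / 2 : ℕ) : ℝ) := Nat.cast_pos.mpr hY
  exact sqrt_oscJunk_le_of_cert P hd hδ₀ hδ₀' (r := 37 / 11) (c := ((7 * t + 20 : ℕ) : ℝ)) hε (by positivity) (by norm_num) (by norm_num)
    hX (by positivity) (by positivity) t hm hM₀ hM hs0 hs he hw hJ

/-- **(B) shallow junk amplitude** (`r = 49/23`, `A* = 13/3`, `D₀ = 3Y`, `2^p = 2^20`, `X = Y`, `M_b = 7t + 20`). [folklore] -/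
theorem sqrt_juncB_le (P : CascadeParams) (hd : P.d = 2) {δs : ℝ} (hδ₀ : 0 ≤ P.δ₀) (hδ₀' : P.δ₀ ≤ δs) {Y : ℕ} (hY : 0 < Y)
    {ε : ℝ} (hε : 0 < ε) (t : ℕ) {m : ℕ} {M₀ s e₀ w : ℝ}
    (hm : 13 / 3 * 3.1416 * 8 * 2 ^ 20 * (Y : ℝ) * 64 ^ t / ε ≤ 2 ^ m) (hM₀ : 1 ≤ M₀) (hM : 1.3862943616 * m ≤ M₀ ^ 2)
    (hs0 : 0 ≤ s) (hs : 4 * (M₀ * (δs / 2 ^ t)) / (3.141592 * (3 * (Y : ℝ))) ≤ s ^ 2) (he : ε ^ 2 ≤ e₀) (hw : 0 ≤ w)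
    (hJ : 3 * (49 / 23) ^ 2 * (4 / 3 * e₀ + 4 / 3 * (2 * 2 ^ t / (3.141592 * (3 * (Y : ℝ)))) ^ 2 +
        8 * 2 ^ t * (13 / 3) / (3.141592 * (3 * (Y : ℝ))) +
        ((7 * t + 20 : ℕ) : ℝ) * (8 * 2 ^ t * (13 / 3) ^ 2 * s + 8 * (13 / 3) ^ 2 * (M₀ * (δs / 2 ^ t)) / 3.141592)) ≤ w ^ 2) :
    Real.sqrt (3 * (49 / 23) ^ 2 *
        (4 / 3 * ε ^ 2 + 4 / 3 * (2 * 2 ^ t / (π * (3 * (Y : ℝ)))) ^ 2 + 8 * 2 ^ t * (13 / 3) / (π * (3 * (Y : ℝ))) +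
          ((7 * t + 20 : ℕ) : ℝ) * (8 * 2 ^ t * (13 / 3) ^ 2 *
            Real.sqrt (4 * (max 1 (Real.sqrt (2 * Real.log (1 / (ε / (13 / 3 * π * 8 * 2 ^ 20 * (Y : ℝ)) * (1 / 64) ^ t)))) * P.δ t) / (π * (3 * (Y : ℝ)))) +
            8 * (13 / 3) ^ 2 * (max 1 (Real.sqrt (2 * Real.log (1 / (ε / (13 / 3 * π * 8 * 2 ^ 20 * (Y : ℝ)) * (1 / 64) ^ t)))) * P.δ t) / π))) ≤ w ∧
      max 1 (Real.sqrt (2 * Real.log (1 / (ε / (13 / 3 * π * 8 * 2 ^ 20 * (Y : ℝ)) * (1 / 64) ^ t)))) * P.δ t ≤ M₀ * (δs / 2 ^ t) := by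
  have hX : (0 : ℝ) < (Y : ℝ) := Nat.cast_pos.mpr hY
  exact sqrt_oscJunk_le_of_cert P hd hδ₀ hδ₀' (r := 49 / 23) (c := ((7 * t + 20 : ℕ) : ℝ)) hε (by positivity) (by norm_num) (by norm_num)
    hX (by positivity) (by positivity) t hm hM₀ hM hs0 hs he hw hJ

/-! ## §4 The far terms at `γ = 8` -/

/-- `(1 + γ)^{2t} = 81^t` at `γ = 8`. [folklore] -/
theorem one_add_gamma_pow_two_mul (P : CascadeParams) (hγ : P.γ = 8) (t : ℕ) : (1 + P.γ) ^ (2 * t) = (81 : ℝ) ^ t := by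
  rw [hγ, pow_mul]; norm_num

/-- **Far energy**: `81^t ≤ ψ·X` (`X > 0`) gives `((1+γ)^{2t}/X)² ≤ ψ²` at `γ = 8`. [folklore] -/
theorem far_sq_le (P : CascadeParams) (hγ : P.γ = 8) {t X : ℕ} {ψ : ℝ} (hX : 0 < X) (h : (81 : ℝ) ^ t ≤ ψ * (X : ℝ)) :
    ((1 + P.γ) ^ (2 * t) / (X : ℝ)) ^ 2 ≤ ψ ^ 2 := by
  have hX' : (0 : ℝ) < X := Nat.cast_pos.mpr hX
  rw [one_add_gamma_pow_two_mul P hγ]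
  exact pow_le_pow_left₀ (by positivity) ((div_le_iff₀ hX').mpr h) 2

/-- **Far amplitude**: `81^t ≤ ψ·X` gives `√(((1+γ)^{2t}/X)²) ≤ ψ` at `γ = 8`. [folklore] -/
theorem sqrt_far_sq_le (P : CascadeParams) (hγ : P.γ = 8) {t X : ℕ} {ψ : ℝ} (hX : 0 < X)
    (h : (81 : ℝ) ^ t ≤ ψ * (X : ℝ)) : Real.sqrt (((1 + P.γ) ^ (2 * t) / (X : ℝ)) ^ 2) ≤ ψ := by
  have hX' : (0 : ℝ) < X := Nat.cast_pos.mpr hX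
  rw [Real.sqrt_sq (by rw [hγ]; positivity), one_add_gamma_pow_two_mul P hγ]
  exact (div_le_iff₀ hX').mpr h

/-- **Far head of the shell chain**: `81^{j₁} ≤ φ·Y` gives `(1+γ)^{2j₁}/Y ≤ φ` at `γ = 8`. [folklore] -/
theorem far_head_le (P : CascadeParams) (hγ : P.γ = 8) {j₁ Y : ℕ} {φ : ℝ} (hY : 0 < Y) (h : (81 : ℝ) ^ j₁ ≤ φ * (Y : ℝ)) :
    (1 + P.γ) ^ (2 * j₁) / (Y : ℝ) ≤ φ := by
  have hY' : (0 : ℝ) < Y := Nat.cast_pos.mpr hY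
  rw [one_add_gamma_pow_two_mul P hγ]
  exact (div_le_iff₀ hY').mpr h

/-! ## §5 The side conditions of the shell chain, all phases at once -/

/-- `√(2 log 64) ≤ 3`. [folklore] -/
theorem sqrt_two_mul_log_64_le : Real.sqrt (2 * Real.log (1 / (1 / 64 : ℝ))) ≤ 3 := by
  refine Real.sqrt_le_iff.mpr ⟨by norm_num, ?_⟩
  rw [one_div_one_div, show (64 : ℝ) = 2 ^ 6 by norm_num, Real.log_pow]
  have := Real.log_two_lt_d9
  push_cast
  nlinarith

/-- **The shell chain's zone conditions for every phase from one certificate**: for `η_i = η₀·(1/64)^i` with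
`η₀ = ε/(A·π·8·P·X)`, `A·3.1416·8·P·X/ε ≤ 2^m`, `1 ≤ M₀`, `1.3862943616·m ≤ M₀²`, `d = 2`, `0 ≤ δ₀ ≤ δ*` and `(M₀ + 4)·δ* < 3/2`:
`max(1,√(2log(1/η_i)))·δ_i < π/2` for all `i`. [folklore] -/
theorem shell_zone_cond (P : CascadeParams) (hd : P.d = 2) {δs : ℝ} (hδ₀ : 0 ≤ P.δ₀) (hδ₀' : P.δ₀ ≤ δs)
    {ε A Pw X : ℝ} (hε : 0 < ε) (hA : 0 < A) (hPw : 0 < Pw) (hX : 0 < X) {m : ℕ} {M₀ : ℝ}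
    (hm : A * 3.1416 * 8 * Pw * X / ε ≤ 2 ^ m) (hM₀ : 1 ≤ M₀) (hM : 1.3862943616 * m ≤ M₀ ^ 2) (hsmall : (M₀ + 4) * δs < 3 / 2) :
    ∀ i : ℕ, max 1 (Real.sqrt (2 * Real.log (1 / (ε / (A * π * 8 * Pw * X) * (1 / 64) ^ i)))) * P.δ i < π / 2 := by
  intro i
  have hπ := Real.pi_gt_three
  obtain ⟨hδ0, hδle⟩ := P.delta_le_of_le hd hδ₀ hδ₀' i
  have hη₀ : 0 < ε / (A * π * 8 * Pw * X) := by have := Real.pi_pos; positivity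
  have haff := zoneDepth_le_affine hη₀ (θ := 1 / 64) (by norm_num) (by norm_num) i
  have hinv : 1 / (ε / (A * π * 8 * Pw * X)) ≤ 2 ^ m := by
    have := inv_rounding_target_le (ε := ε) (A := A) (Pw := Pw) (X := X) 0 hε hA.le hPw.le hX.le
    rw [pow_zero, mul_one, pow_zero, mul_one] at this
    exact this.trans hm
  have h0 : Real.sqrt (2 * Real.log (1 / (ε / (A * π * 8 * Pw * X)))) ≤ M₀ :=
    (le_max_right _ _).trans (zoneDepth_le hη₀ hinv hM₀ hM)
  have h64 := sqrt_two_mul_log_64_le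
  have hi : (0 : ℝ) ≤ i := Nat.cast_nonneg i
  have hM : max 1 (Real.sqrt (2 * Real.log (1 / (ε / (A * π * 8 * Pw * X) * (1 / 64) ^ i)))) ≤ (1 + M₀) + 3 * i := by
    have := mul_le_mul_of_nonneg_right h64 hi
    linarith
  have hδs0 : 0 ≤ δs := hδ₀.trans hδ₀'
  have h2 : ((1 + M₀) + 3 * i) * (δs / 2 ^ i) ≤ ((1 + M₀) + 3) * δs := by
    have := affine_div_two_pow_le (α := 1 + M₀) (β := 3) (by linarith) (by norm_num) i
    calc ((1 + M₀) + 3 * i) * (δs / 2 ^ i) = ((1 + M₀) + 3 * i) / 2 ^ i * δs := by ring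
      _ ≤ ((1 + M₀) + 3) * δs := mul_le_mul_of_nonneg_right this hδs0
  calc max 1 (Real.sqrt (2 * Real.log (1 / (ε / (A * π * 8 * Pw * X) * (1 / 64) ^ i)))) * P.δ i
      ≤ ((1 + M₀) + 3 * i) * (δs / 2 ^ i) := mul_le_mul hM hδle hδ0 (by positivity)
    _ ≤ ((1 + M₀) + 3) * δs := h2
    _ < π / 2 := by linarith

/-! ## §6 One summand of the shell chain and the resolved increment -/

/-- **One summand of the shell chain against rationals**: `√J_A ≤ w_A`, `√J_B ≤ w_B`, `√f_A ≤ ψ_A`, `√f_B ≤ ψ_B` give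
`√J_A + √J_B + √f_A + √f_B ≤ w_A + w_B + ψ_A + ψ_B`. [folklore] -/
theorem omega_osc_le {JA JB fA fB wA wB ψA ψB : ℝ} (hA : Real.sqrt JA ≤ wA) (hB : Real.sqrt JB ≤ wB) (hfA : Real.sqrt fA ≤ ψA)
    (hfB : Real.sqrt fB ≤ ψB) : Real.sqrt JA + Real.sqrt JB + Real.sqrt fA + Real.sqrt fB ≤ wA + wB + ψA + ψB := by
  linarith

/-- **THE RESOLVED INCREMENT AGAINST CERTIFIED AMPLITUDES** (shape of `…PhaseStepOsc.resolved_step_osc`; the off-cone amplitude `o ≥ 0`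
is kept): `√J_T ≤ w_T`, `√J_S ≤ w_S`, `√J_C ≤ w_C`, `√J_O ≤ w_O`, `0 ≤ 𝔞 ≤ α`, `√f_C ≤ ψ`, `f_S ≤ φ_S`, `f_T ≤ φ_T`, `f_O ≤ φ_O`
give `√J_T² + 2√J_T·o + (√J_S + √J_C + 𝔞 + √f_C)² + (√J_O + √J_C + 𝔞 + √f_C)² + f_S + f_T + f_O`
`≤ w_T² + 2w_T·o + (w_S + w_C + α + ψ)² + (w_O + w_C + α + ψ)² + φ_S + φ_T + φ_O`. [folklore] -/
theorem resolvedJunk_le {JT JS JC JO 𝔞 fC fS fT fO o wT wS wC wO α ψ φS φT φO : ℝ} (hT : Real.sqrt JT ≤ wT)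
    (hS : Real.sqrt JS ≤ wS) (hC : Real.sqrt JC ≤ wC) (hO : Real.sqrt JO ≤ wO) (h𝔞0 : 0 ≤ 𝔞) (h𝔞 : 𝔞 ≤ α)
    (hfC : Real.sqrt fC ≤ ψ) (hfS : fS ≤ φS) (hfT : fT ≤ φT) (hfO : fO ≤ φO) (ho : 0 ≤ o) :
    Real.sqrt JT ^ 2 + 2 * Real.sqrt JT * o + (Real.sqrt JS + Real.sqrt JC + 𝔞 + Real.sqrt fC) ^ 2 +
        (Real.sqrt JO + Real.sqrt JC + 𝔞 + Real.sqrt fC) ^ 2 + fS + fT + fO ≤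
      wT ^ 2 + 2 * wT * o + (wS + wC + α + ψ) ^ 2 + (wO + wC + α + ψ) ^ 2 + φS + φT + φO := by
  have h1 : Real.sqrt JT ^ 2 ≤ wT ^ 2 := pow_le_pow_left₀ (Real.sqrt_nonneg _) hT 2
  have h2 : 2 * Real.sqrt JT * o ≤ 2 * wT * o := by nlinarith [Real.sqrt_nonneg JT]
  have h3 := sq_window_amplitude_le hS hC h𝔞0 h𝔞 hfC
  have h4 := sq_window_amplitude_le hO hC h𝔞0 h𝔞 hfC
  linarith

/-- **The next off-cone amplitude against certified amplitudes** (shape of `…LedgerFeedChain.sqrt_offCone_next_le` after the Osc windows):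
`√J_O + √J_C + 𝔞 + √f_C + √f_O ≤ w_O + w_C + α + ψ + ψ_O`. [folklore] -/
theorem offConeNext_le {JO JC 𝔞 fC fO wO wC α ψ ψO : ℝ} (hO : Real.sqrt JO ≤ wO) (hC : Real.sqrt JC ≤ wC) (h𝔞 : 𝔞 ≤ α)
    (hfC : Real.sqrt fC ≤ ψ) (hfO : Real.sqrt fO ≤ ψO) :
    Real.sqrt JO + Real.sqrt JC + 𝔞 + Real.sqrt fC + Real.sqrt fO ≤ wO + wC + α + ψ + ψO := by
  linarith

end Summit.AnomalousDissipation.AnomalousDissipation.Theorems.SawtoothPulseCascade.K1Window
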